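/-
Copyright (c) 2026 the pub-hodgecm-mathlib formalisation cell (harness21).  Prover seat hodgecm-mathlib-K2E3-p25 (g2), HCML Track B «K2-LIT»,
h413 = `stmt-HodgeConjecture-24833`, road (11-3-split-nsc), leaf (nsc-S-A′) `sig_K2E3GL3PrincipalBlockStandardSpan` (U12 :463), brick PEEL (file 3 of 3) of the leaf
owner's `K2/K2E3-p25/g2/MEMO-SA-architecture.v2.K2E3-p25-g2.md` §2 (feed (B) of H0).  2026-09-04.
-/
import Summits.HodgeConjecture.HodgeConjecture.Theorems.K2E3GL2JacquetPeelingStep   -- ★ PEEL file 2: `exists_peel`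
import HarnessLib

/-!
# K2_E3 road (h413), leaf (nsc-S-A′), brick PEEL (file 3 of 3) — THE SWAP AND PARITY RULES for the Jacquet exponents of a `GL₂(F)`-representation WITH A COMMUTING
# ACTION, by Frobenius peeling (no composition series, no finite length)

Cell `pub/hodgecm-mathlib` (D-0151), Track B, seat K2E3-p25 (g2) (leaf owner ∕ architect).  `--supports stmt-HodgeConjecture-24833 --as helper`; THEOREMS ONLY
(no `def`, no instance, no notation, no `sorry`); never imports `Cruxes/…/Lines`.  COUNT-NEUTRAL.  Setting and currency: ★ PEEL files 1–2 (`K2E3GL2JacquetProdRep`,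
`K2E3GL2JacquetPeelingStep`): `W : Representation ℂ (GL (Fin 2) F) X` smooth with finite-dimensional `U₂`-coinvariants, `ζ : Representation ℂ D X` commuting with `W`
(`D` with commuting elements), `τ` the `T₂ × D`-action on the coinvariants (`hτ₁ : τ (t,1) = normalizedJacquetGL … t`, `hτ₂ : τ (1,d) [v] = [ζ d v]`), weights
`(x ⊠ y) ⊗ ξ := fun p => maxParabolicLeviChar F 2 x y p.1 * ξ p.2`, `mult τ η := finrank ℂ ↥(⨅ p, maxGenEigenspace (τ p) (η p))`.

THE RESULTS (strong induction on `finrank C(X)`, peeling with ★ `exists_peel` while the weight occurs):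
* **`finrank_weightSpace_le_swap`**: `(I₂ x y).IsIrreducible → mult τ ((x⊠y)⊗ξ) ≤ mult τ ((y⊠x)⊗ξ)`;
* **`finrank_weightSpace_swap`** — RULE (s): `I₂ x y`, `I₂ y x` irreducible (e.g. `x, y` unlinked, ★ GL2-UNL) ⇒ `mult τ ((x⊠y)⊗ξ) = mult τ ((y⊠x)⊗ξ)`;
* **`even_finrank_weightSpace_self`** — RULE (par): `I₂ x x` irreducible (always, ★ GL2-UNL) ⇒ `mult τ ((x⊠x)⊗ξ)` is EVEN.
With `D = GL₁(F)` and the BRIDGE `r_B = r_{B₂} ∘ r_{P₂₁}` (★ K2E3-p14 `K2E3GL3JacquetInStagesBorel` + packaging) these are the rules (s₁)∕(par) of the H0 layer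
`K2E3GL3ExponentRules` of the leaf's exponent calculus on `GL₃(F)`; (s₂) is the `P₁₂`-twin.  No finite-length ∕ Howe input is used.
[BernsteinZelevinsky1977, Thm. 2.5, Cor. 2.13, Thm. 5.2; Zelevinsky1980, Thm. 1.9, §3.2 Example p. 181; Casselman1995, §6.3, Lemma 7.1.1; Bump1997, Thm. 4.5.4]

HONEST LABEL: HC_CM is proved only modulo the 7 printed citations (2 remaining named inputs: hLiu418 = stmt-HodgeConjecture-24832, h413 = stmt-HodgeConjecture-24833) until rung 0
closes; count-neutral generic helper.

## References
* [BernsteinZelevinsky1977] I. N. Bernstein, A. V. Zelevinsky, *Induced representations of reductive p-adic groups I*, Ann. Sci. ÉNS 10 (1977), Thm. 2.5, Cor. 2.13, Thm. 5.2.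
* [Zelevinsky1980] A. V. Zelevinsky, *Induced representations of reductive p-adic groups II*, Ann. Sci. ÉNS 13 (1980), Thm. 1.9, §3.2 Example p. 181.
* [Casselman1995] W. Casselman, *Introduction to the theory of admissible representations of p-adic reductive groups* (draft 1 May 1995), §6.3, Lemma 7.1.1.
* [Bump1997] D. Bump, *Automorphic Forms and Representations* (1997), Thm. 4.5.4.
-/

set_option autoImplicit false
set_option linter.dupNamespace false

noncomputable section

open Module Module.End Function
open scoped MatrixGroups
open Literature.NumberTheory.Automorphic Literature.NumberTheory.Automorphic.Zelevinsky1980 ValuativeRel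
open Summit.HodgeConjecture.HodgeConjecture.Cruxes.H413.K2E3GL2JacquetModuleStructure
open Summit.HodgeConjecture.HodgeConjecture.Cruxes.H413.K2E3GL2JacquetExponents
open Summit.HodgeConjecture.HodgeConjecture.Cruxes.H413.K2E3JacquetExponentMultiset
open Summit.HodgeConjecture.HodgeConjecture.Cruxes.H413.K2E3JacquetExponentEigenvector
open Summit.HodgeConjecture.HodgeConjecture.Cruxes.H413.K2E3GL2JacquetProdRep
open Summit.HodgeConjecture.HodgeConjecture.Cruxes.H413.K2E3GL2JacquetPeelingStep

namespace Summit.HodgeConjecture.HodgeConjecture.Cruxes.H413.K2E3GL2JacquetPeelingRules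

/-! ## §3 The rules: swap inequality, swap symmetry, parity -/

section Rules

variable {F : Type} [Field F] [ValuativeRel F] [TopologicalSpace F] [IsNonarchimedeanLocalField F]
variable {D : Type} [Group D]

/-- Induction carrier for `finrank_weightSpace_le_swap` (strong induction on `finrank C(X)`, peeling while the weight `(x ⊠ y) ⊗ ξ` occurs).
[cite: BernsteinZelevinsky1977, Thm. 2.5, Cor. 2.13] [cite: Casselman1995, §6.3] -/
theorem finrank_weightSpace_le_swap_aux (hD : ∀ d d' : D, d * d' = d' * d) (n : ℕ) :
    ∀ {X : Type} [AddCommGroup X] [Module ℂ X] (W : Representation ℂ (GL (Fin 2) F) X) (_hW : W.IsSmooth) (ζ : Representation ℂ D X)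
      (_hWζ : ∀ g d, W g * ζ d = ζ d * W g)
      (τ : Representation ℂ ((Π a : Bool, GL {i : Fin 2 // lastBlockLabel 2 i = a} F) × D) (Representation.restrictUnipotentGL F (lastBlockLabel 2) W).Coinvariants)
      (_hτ₁ : ∀ t, τ (t, 1) = Representation.normalizedJacquetGL F (lastBlockLabel 2) W t)
      (_hτ₂ : ∀ d v, τ (1, d) (Representation.Coinvariants.mk _ v) = Representation.Coinvariants.mk _ (ζ d v))
      [FiniteDimensional ℂ (Representation.restrictUnipotentGL F (lastBlockLabel 2) W).Coinvariants],
      finrank ℂ (Representation.restrictUnipotentGL F (lastBlockLabel 2) W).Coinvariants = n →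
      ∀ (x y : Fˣ →* ℂˣ) (_hx : IsOpen (x.ker : Set Fˣ)) (_hy : IsOpen (y.ker : Set Fˣ))
        (_h₁ : (Representation.parabolicIndGL F (lastBlockLabel 2)
          ((Representation.trivial ℂ (Π a : Bool, GL {i : Fin 2 // lastBlockLabel 2 i = a} F) ℂ).twist (maxParabolicLeviChar F 2 x y))).IsIrreducible)
        (ξ : D → ℂ),
        finrank ℂ ↥(⨅ p, Module.End.maxGenEigenspace (τ p) (((maxParabolicLeviChar F 2 x y p.1 : ℂˣ) : ℂ) * ξ p.2)) ≤
          finrank ℂ ↥(⨅ p, Module.End.maxGenEigenspace (τ p) (((maxParabolicLeviChar F 2 y x p.1 : ℂˣ) : ℂ) * ξ p.2)) := by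
  induction n using Nat.strong_induction_on with
  | _ n ih =>
    intro X _ _ W hW ζ hWζ τ hτ₁ hτ₂ _ hn x y hx hy h₁ ξ
    by_cases hne : (⨅ p, Module.End.maxGenEigenspace (τ p) (((maxParabolicLeviChar F 2 x y p.1 : ℂˣ) : ℂ) * ξ p.2)) = ⊥
    · rw [hne, finrank_bot]
      exact Nat.zero_le _
    · obtain ⟨K, ζK, τK, _, hWζK, hKsm, hτK₁, hτK₂, hfdK, hlt, e₁, e₂⟩ := exists_peel hD W hW ζ hWζ τ hτ₁ hτ₂ x y hx hy h₁ ξ hne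
      haveI := hfdK
      have ihK := ih _ (hn ▸ hlt) K.toRepresentation hKsm ζK hWζK τK hτK₁ hτK₂ rfl x y hx hy h₁ ξ
      omega

/-- **THE SWAP INEQUALITY.**  If `I₂ x y` is irreducible then `mult τ ((x ⊠ y) ⊗ ξ) ≤ mult τ ((y ⊠ x) ⊗ ξ)` for every `ξ : D → ℂ`: peel the weight `(x ⊠ y) ⊗ ξ` as long as it occurs
(`exists_peel`); each peel removes `x ⊠ y` and `y ⊠ x` equally often (★ G1 (a)). [cite: BernsteinZelevinsky1977, Thm. 2.5, Cor. 2.13, Thm. 5.2] [cite: Casselman1995, §6.3, Lemma 7.1.1] -/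
theorem finrank_weightSpace_le_swap (hD : ∀ d d' : D, d * d' = d' * d) {X : Type} [AddCommGroup X] [Module ℂ X]
    (W : Representation ℂ (GL (Fin 2) F) X) (hW : W.IsSmooth) (ζ : Representation ℂ D X) (hWζ : ∀ g d, W g * ζ d = ζ d * W g)
    (τ : Representation ℂ ((Π a : Bool, GL {i : Fin 2 // lastBlockLabel 2 i = a} F) × D) (Representation.restrictUnipotentGL F (lastBlockLabel 2) W).Coinvariants)
    (hτ₁ : ∀ t, τ (t, 1) = Representation.normalizedJacquetGL F (lastBlockLabel 2) W t)
    (hτ₂ : ∀ d v, τ (1, d) (Representation.Coinvariants.mk _ v) = Representation.Coinvariants.mk _ (ζ d v))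
    [FiniteDimensional ℂ (Representation.restrictUnipotentGL F (lastBlockLabel 2) W).Coinvariants]
    (x y : Fˣ →* ℂˣ) (hx : IsOpen (x.ker : Set Fˣ)) (hy : IsOpen (y.ker : Set Fˣ))
    (h₁ : (Representation.parabolicIndGL F (lastBlockLabel 2)
      ((Representation.trivial ℂ (Π a : Bool, GL {i : Fin 2 // lastBlockLabel 2 i = a} F) ℂ).twist (maxParabolicLeviChar F 2 x y))).IsIrreducible)
    (ξ : D → ℂ) :
    finrank ℂ ↥(⨅ p, Module.End.maxGenEigenspace (τ p) (((maxParabolicLeviChar F 2 x y p.1 : ℂˣ) : ℂ) * ξ p.2)) ≤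
      finrank ℂ ↥(⨅ p, Module.End.maxGenEigenspace (τ p) (((maxParabolicLeviChar F 2 y x p.1 : ℂˣ) : ℂ) * ξ p.2)) :=
  finrank_weightSpace_le_swap_aux hD _ W hW ζ hWζ τ hτ₁ hτ₂ rfl x y hx hy h₁ ξ

/-- **RULE (s): THE SWAP SYMMETRY OF THE JACQUET EXPONENTS WITH A COMMUTING ACTION.**  If `I₂ x y` AND `I₂ y x` are irreducible (e.g. `x, y` unlinked, ★ GL2-UNL) then
`mult τ ((x ⊠ y) ⊗ ξ) = mult τ ((y ⊠ x) ⊗ ξ)` for every `ξ : D → ℂ` — for ANY smooth `W` with finite-dimensional Jacquet module and any commuting `D`-action (no finite length, no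
composition series).  With `D = GL₁(F)` and the BRIDGE `r_B = r_{B₂} ∘ r_{P₂₁}` this is rule (s₁) `mult V (x,y,z) = mult V (y,x,z)` of the leaf's exponent calculus on `GL₃(F)`.
[cite: BernsteinZelevinsky1977, Thm. 2.5, Cor. 2.13] [cite: Zelevinsky1980, Thm. 1.9, §3.2] [cite: Casselman1995, §6.3, Lemma 7.1.1] -/
theorem finrank_weightSpace_swap (hD : ∀ d d' : D, d * d' = d' * d) {X : Type} [AddCommGroup X] [Module ℂ X]
    (W : Representation ℂ (GL (Fin 2) F) X) (hW : W.IsSmooth) (ζ : Representation ℂ D X) (hWζ : ∀ g d, W g * ζ d = ζ d * W g)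
    (τ : Representation ℂ ((Π a : Bool, GL {i : Fin 2 // lastBlockLabel 2 i = a} F) × D) (Representation.restrictUnipotentGL F (lastBlockLabel 2) W).Coinvariants)
    (hτ₁ : ∀ t, τ (t, 1) = Representation.normalizedJacquetGL F (lastBlockLabel 2) W t)
    (hτ₂ : ∀ d v, τ (1, d) (Representation.Coinvariants.mk _ v) = Representation.Coinvariants.mk _ (ζ d v))
    [FiniteDimensional ℂ (Representation.restrictUnipotentGL F (lastBlockLabel 2) W).Coinvariants]
    (x y : Fˣ →* ℂˣ) (hx : IsOpen (x.ker : Set Fˣ)) (hy : IsOpen (y.ker : Set Fˣ))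
    (h₁ : (Representation.parabolicIndGL F (lastBlockLabel 2)
      ((Representation.trivial ℂ (Π a : Bool, GL {i : Fin 2 // lastBlockLabel 2 i = a} F) ℂ).twist (maxParabolicLeviChar F 2 x y))).IsIrreducible)
    (h₂ : (Representation.parabolicIndGL F (lastBlockLabel 2)
      ((Representation.trivial ℂ (Π a : Bool, GL {i : Fin 2 // lastBlockLabel 2 i = a} F) ℂ).twist (maxParabolicLeviChar F 2 y x))).IsIrreducible)
    (ξ : D → ℂ) :
    finrank ℂ ↥(⨅ p, Module.End.maxGenEigenspace (τ p) (((maxParabolicLeviChar F 2 x y p.1 : ℂˣ) : ℂ) * ξ p.2)) =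
      finrank ℂ ↥(⨅ p, Module.End.maxGenEigenspace (τ p) (((maxParabolicLeviChar F 2 y x p.1 : ℂˣ) : ℂ) * ξ p.2)) :=
  le_antisymm (finrank_weightSpace_le_swap hD W hW ζ hWζ τ hτ₁ hτ₂ x y hx hy h₁ ξ) (finrank_weightSpace_le_swap hD W hW ζ hWζ τ hτ₁ hτ₂ y x hy hx h₂ ξ)

/-- Induction carrier for `even_finrank_weightSpace_self`. [cite: BernsteinZelevinsky1977, Thm. 2.5, Cor. 2.13] [cite: Bump1997, Thm. 4.5.4] -/
theorem even_finrank_weightSpace_self_aux (hD : ∀ d d' : D, d * d' = d' * d) (n : ℕ) :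
    ∀ {X : Type} [AddCommGroup X] [Module ℂ X] (W : Representation ℂ (GL (Fin 2) F) X) (_hW : W.IsSmooth) (ζ : Representation ℂ D X)
      (_hWζ : ∀ g d, W g * ζ d = ζ d * W g)
      (τ : Representation ℂ ((Π a : Bool, GL {i : Fin 2 // lastBlockLabel 2 i = a} F) × D) (Representation.restrictUnipotentGL F (lastBlockLabel 2) W).Coinvariants)
      (_hτ₁ : ∀ t, τ (t, 1) = Representation.normalizedJacquetGL F (lastBlockLabel 2) W t)
      (_hτ₂ : ∀ d v, τ (1, d) (Representation.Coinvariants.mk _ v) = Representation.Coinvariants.mk _ (ζ d v))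
      [FiniteDimensional ℂ (Representation.restrictUnipotentGL F (lastBlockLabel 2) W).Coinvariants],
      finrank ℂ (Representation.restrictUnipotentGL F (lastBlockLabel 2) W).Coinvariants = n →
      ∀ (x : Fˣ →* ℂˣ) (_hx : IsOpen (x.ker : Set Fˣ))
        (_h : (Representation.parabolicIndGL F (lastBlockLabel 2)
          ((Representation.trivial ℂ (Π a : Bool, GL {i : Fin 2 // lastBlockLabel 2 i = a} F) ℂ).twist (maxParabolicLeviChar F 2 x x))).IsIrreducible)
        (ξ : D → ℂ),
        Even (finrank ℂ ↥(⨅ p, Module.End.maxGenEigenspace (τ p) (((maxParabolicLeviChar F 2 x x p.1 : ℂˣ) : ℂ) * ξ p.2))) := by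
  classical
  induction n using Nat.strong_induction_on with
  | _ n ih =>
    intro X _ _ W hW ζ hWζ τ hτ₁ hτ₂ _ hn x hx h ξ
    by_cases hne : (⨅ p, Module.End.maxGenEigenspace (τ p) (((maxParabolicLeviChar F 2 x x p.1 : ℂˣ) : ℂ) * ξ p.2)) = ⊥
    · rw [hne, finrank_bot]
      exact ⟨0, rfl⟩
    · obtain ⟨K, ζK, τK, _, hWζK, hKsm, hτK₁, hτK₂, hfdK, hlt, e₁, _⟩ := exists_peel hD W hW ζ hWζ τ hτ₁ hτ₂ x x hx hx h ξ hne
      haveI := hfdK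
      have ihK := ih _ (hn ▸ hlt) K.toRepresentation hKsm ζK hWζK τK hτK₁ hτK₂ rfl x hx h ξ
      have h2 : finrank ℂ ↥(⨅ m, Module.End.maxGenEigenspace
          (Representation.normalizedJacquetGL F (lastBlockLabel 2) (Representation.parabolicIndGL F (lastBlockLabel 2)
            ((Representation.trivial ℂ (Π a : Bool, GL {i : Fin 2 // lastBlockLabel 2 i = a} F) ℂ).twist (maxParabolicLeviChar F 2 x x))) m)
          ((maxParabolicLeviChar F 2 x x m : ℂˣ) : ℂ)) = 2 := by
        rw [finrank_weightSpace_parabolicIndGL x x hx hx (maxParabolicLeviChar F 2 x x), if_pos rfl]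
      rw [e₁, h2]
      exact ihK.add ⟨1, rfl⟩

/-- **RULE (par): PARITY.**  If `I₂ x x` is irreducible (it always is, ★ GL2-UNL `isIrreducible_parabolicIndGL_two_self`) then `mult τ ((x ⊠ x) ⊗ ξ)` is EVEN for every
`ξ : D → ℂ`: each peel of the weight `(x ⊠ x) ⊗ ξ` removes it exactly twice (★ G1 (a): `mult (I₂ x x) (x ⊠ x) = 2`).  With the BRIDGE this is rule (par) `mult V (x,x,z)` even.
[cite: BernsteinZelevinsky1977, Thm. 2.5, Cor. 2.13] [cite: Bump1997, Thm. 4.5.4] [cite: Casselman1995, §6.3] -/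
theorem even_finrank_weightSpace_self (hD : ∀ d d' : D, d * d' = d' * d) {X : Type} [AddCommGroup X] [Module ℂ X]
    (W : Representation ℂ (GL (Fin 2) F) X) (hW : W.IsSmooth) (ζ : Representation ℂ D X) (hWζ : ∀ g d, W g * ζ d = ζ d * W g)
    (τ : Representation ℂ ((Π a : Bool, GL {i : Fin 2 // lastBlockLabel 2 i = a} F) × D) (Representation.restrictUnipotentGL F (lastBlockLabel 2) W).Coinvariants)
    (hτ₁ : ∀ t, τ (t, 1) = Representation.normalizedJacquetGL F (lastBlockLabel 2) W t)
    (hτ₂ : ∀ d v, τ (1, d) (Representation.Coinvariants.mk _ v) = Representation.Coinvariants.mk _ (ζ d v))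
    [FiniteDimensional ℂ (Representation.restrictUnipotentGL F (lastBlockLabel 2) W).Coinvariants]
    (x : Fˣ →* ℂˣ) (hx : IsOpen (x.ker : Set Fˣ))
    (h : (Representation.parabolicIndGL F (lastBlockLabel 2)
      ((Representation.trivial ℂ (Π a : Bool, GL {i : Fin 2 // lastBlockLabel 2 i = a} F) ℂ).twist (maxParabolicLeviChar F 2 x x))).IsIrreducible)
    (ξ : D → ℂ) :
    Even (finrank ℂ ↥(⨅ p, Module.End.maxGenEigenspace (τ p) (((maxParabolicLeviChar F 2 x x p.1 : ℂˣ) : ℂ) * ξ p.2))) :=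
  even_finrank_weightSpace_self_aux hD _ W hW ζ hWζ τ hτ₁ hτ₂ rfl x hx h ξ

end Rules

end Summit.HodgeConjecture.HodgeConjecture.Cruxes.H413.K2E3GL2JacquetPeelingRules

end
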